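/- Copyright: the b2b-balaban cell (near-miss cell 7), T⁴-continuum fan-out; row NE7b OWNER lineage `t4-ne7b-p1`
(gen 56) — companion of (ρ1) «THE INDEX READING IS A COUNT» and of «FIELD SIGHT»: «UNDER (ρ0) THE LIVE LINES COVER
EVERY REGION EVER BORN».  Released under the licence of the surrounding project. -/
import Summits.QuantumFields.BalabanUV.T4Continuum.Support.HistoryGenealogyLineClean
import Summits.QuantumFields.BalabanUV.T4Continuum.Support.HistoryGenealogyLiveIndex

/-!
# «UNDER (ρ0) THE LIVE LINES COVER EVERY REGION EVER BORN»: the orbit of a new region is carried, level by level, inside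
the domain of a live line for as long as that line is alive — hence, under `NoHealing`, up to the cutoff

Summits-side support leaf of the T⁴-continuum cell (rung (B)+1 on a FINITE torus only; NOT infinite volume, NOT the
mass gap, NOT Clay; NOT a proof of NE7b — the cell's OWN estimate, NOT PRINTED, NOT PROVED).  [folklore] finite
combinatorics over print's memory-generic process AS DEFINED in the tree (`HistoryGenealogyInstantiateM`: `RunInputM`,
`vertM`, `blocksM`, `newLineM`, `StM`, `AliveM`; `HistoryTouchComponents`: `tcomp_mem_tcomps`, `mem_tcomp_self`;
`B16MergeGeometry.subset_fam`; `B16SProfile.Sop_mono`; `HistoryRealise.orbit`, `HistoryGenealogyLineClean.orbit_succ_shift`;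
`HistoryGenealogyLiveIndex.NoHealing`); nothing printed is asserted, no `def … : Prop` fact, no cite-tagged hypothesis,
zero `sorry`.  B16 = [Balaban1989LargeFieldII] (1.71) p. 378 (sequences «restricted to the component») and p. 384 (the
operation S) are LOCATORS only.

WHY.  (ρ1)'s residual reading after `HistoryBankingFibreCount` is «the history pairs of a key fibre ARE the admissible
sub-sequences on its members» — (1.71)'s «{Ω^c_j ∩ X, Z_j ∩ X}» RESTRICTED TO THE COMPONENT.  On OUR process that
restriction has a geometric presupposition: every large-field region the history created is, at the cutoff, INSIDE
some live member.  This file proves it for the pass-V process: the orbit `S^k` of a region born at level `j` lies in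
the domain of a live line of level `j + k` whenever the line carrying it stayed alive at every intermediate level
(`orbit_subset_live_of_alive`), and under (ρ0) `NoHealing K` — no line dies below the cutoff — for every `j + k ≤ K`
(`orbit_subset_live_of_noHealing`; cover form `regions_covered_at_cutoff`).  With `HistoryGenealogyLineClean.D_eq_orbit`
(a live domain IS the orbit of its last-event domain) this is the clause «supported in the members' orbits»; with
`HistoryGenealogyFieldSight` (the new-field input is NOT on the live index) it delineates what a key read off the live
lines can and cannot see: regions yes, fields no.

WHAT.  §1 `P_inl`, `P_inr`, `exists_line_of_vertex` (every vertex of the step lies in the domain of a formed line);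
§2 `region_subset_line` (a region born at `j` lies in a line of `StM j`), `orbit_succ_subset_line` (one step along an
ALIVE carrier), **`orbit_subset_live_of_alive`**; §3 **`orbit_subset_live_of_noHealing`**, **`regions_covered_at_cutoff`**;
§4 the decided content on the LiveIndex toy (`toy_cover_two`: the origin cube's orbit at level `2` sits in the one
live line; at `K = 3` the hypothesis fails with the line — `HistoryGenealogyFieldSight.toy_StM_three`).

HONEST.  Kernel bookkeeping on OUR process definition; BY-NAME EFFECT ON THE WALL: NONE (information for (ρ1)'s residual
identification); NE7b NOT PRINTED ∕ NOT PROVED; spine 0∕9.  HONEST DEPENDENCY (cell): continuum YM on T⁴ ⇐ BetaPertH ∧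
nine spine estimates (0/9 proved); BetaPertH ⇐ (D1) ∧ (D4) ∧ CAP+tail; G-an2-4 gates asym, D1 and NE2/3/4.  This file
changes none of it.
-/

open Finset
open Literature.MathematicalPhysics.QuantumFieldTheory.Balaban1983to89
open Literature.MathematicalPhysics.QuantumFieldTheory.Balaban1983to89.B13ScaleTransfer
open Literature.MathematicalPhysics.QuantumFieldTheory.Balaban1983to89.TreeLength
open Literature.MathematicalPhysics.QuantumFieldTheory.Balaban1983to89.B16SProfile
open Literature.MathematicalPhysics.QuantumFieldTheory.Balaban1983to89.B16MergeGeometry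
open Summit.QuantumFields.BalabanUV.T4Continuum.HistoryRealise
open Summit.QuantumFields.BalabanUV.T4Continuum.HistoryRealiseMemory
open Summit.QuantumFields.BalabanUV.T4Continuum.HistoryGenealogyExtraction
open Summit.QuantumFields.BalabanUV.T4Continuum.HistoryGenealogyRealise
open Summit.QuantumFields.BalabanUV.T4Continuum.HistoryTouchComponents

namespace Summit.QuantumFields.BalabanUV.T4Continuum.HistoryGenealogyInstantiate

noncomputable section

open Classical

variable {d : ℕ}

namespace RunInputM

variable (I : RunInputM d)

/-! ## §1 Every vertex of a step lies in the domain of a formed line -/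

/-- the image of an old vertex at level `ℓ`: one S-operation of its domain at the ratio of level `ℓ − 1` [folklore] -/
theorem P_inl (ℓ : ℕ) (τ : Line d) : I.P ℓ (Sum.inl τ) = Sop (ratio I.L I.s (ℓ - 1)) τ.D := rfl

/-- the image of a new vertex: the region itself [folklore] -/
theorem P_inr (ℓ : ℕ) (n : Lab d) : I.P ℓ (Sum.inr n) = n.2 := rfl

/-- **EVERY VERTEX IS SWALLOWED BY A FORMED LINE**: the image of a vertex of the step at level `ℓ` from `prev` lies in
the domain of some line of `formM ℓ prev` (the new line of the vertex's own touch-block). [folklore] -/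
theorem exists_line_of_vertex (ℓ : ℕ) (prev : Finset (Line d)) {v : Line d ⊕ Lab d} (hv : v ∈ I.vertM ℓ prev) :
    ∃ τ ∈ I.formM ℓ prev, I.P ℓ v ⊆ τ.D := by
  refine ⟨I.newLineM ℓ (tcomp (I.P ℓ) (I.vertM ℓ prev) v), ?_, ?_⟩
  · exact Finset.mem_image_of_mem _ (tcomp_mem_tcomps hv)
  · rw [newLineM_D]
    exact subset_fam (I.P ℓ) (mem_tcomp_self hv)

/-! ## §2 A region is carried inside a live line for as long as the carrier is alive -/

/-- **A REGION BORN AT LEVEL `j` LIES IN A LIVE LINE OF LEVEL `j`** (the line of its own block). [folklore] -/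
theorem region_subset_line {j : ℕ} {n : Lab d} (hn : n ∈ I.N j) : ∃ τ ∈ I.StM j, n.2 ⊆ τ.D := by
  obtain ⟨τ, hτ, hsub⟩ := I.exists_line_of_vertex j (I.PrevM j) ((I.inr_mem_vertM).2 hn)
  exact ⟨τ, by rw [StM_eq_formM]; exact hτ, hsub⟩

/-- **ONE STEP ALONG AN ALIVE CARRIER**: if `X` lies in the domain of a line of level `ℓ` that is alive after the
𝐑-operation of level `ℓ`, then `Sop (ratio L s ℓ) X` lies in the domain of a line of level `ℓ + 1`. [folklore] -/
theorem sop_subset_line_succ {ℓ : ℕ} {X : Finset (Pt d)} {τ : Line d} (hτ : τ ∈ I.StM ℓ) (ha : I.AliveM ℓ τ)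
    (hX : X ⊆ τ.D) : ∃ τ' ∈ I.StM (ℓ + 1), Sop (ratio I.L I.s ℓ) X ⊆ τ'.D := by
  have hv : Sum.inl τ ∈ I.vertM (ℓ + 1) (I.StM ℓ) := (I.inl_mem_vertM).2 ⟨hτ, by rw [Nat.add_sub_cancel]; exact ha⟩
  obtain ⟨τ', hτ', hsub⟩ := I.exists_line_of_vertex (ℓ + 1) (I.StM ℓ) hv
  refine ⟨τ', by rw [StM_eq_formM]; exact hτ', ?_⟩
  rw [P_inl, Nat.add_sub_cancel] at hsub
  exact (Sop_mono _ hX).trans hsub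

/-- **THE ORBIT OF A BORN REGION IS CARRIED INSIDE A LIVE LINE WHILE ITS CARRIERS STAY ALIVE**: if every line of the
levels `j, …, j + k − 1` is alive after its level's 𝐑-operation, the `k`-th S-image of a region born at `j` lies in the
domain of a line of `StM (j + k)`. [folklore] -/
theorem orbit_subset_live_of_alive {j : ℕ} {n : Lab d} (hn : n ∈ I.N j) :
    ∀ k, (∀ i, i < k → ∀ τ ∈ I.StM (j + i), I.AliveM (j + i) τ) →
      ∃ τ ∈ I.StM (j + k), orbit I.L I.s j n.2 k ⊆ τ.D := by
  intro k
  induction k with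
  | zero =>
      intro _
      rw [Nat.add_zero, orbit_zero]
      exact I.region_subset_line hn
  | succ k ih =>
      intro ha
      obtain ⟨τ, hτ, hsub⟩ := ih fun i hi => ha i (Nat.lt_succ_of_lt hi)
      obtain ⟨τ', hτ', hsub'⟩ := I.sop_subset_line_succ hτ (ha k (Nat.lt_succ_self k) τ hτ) hsub
      refine ⟨τ', by rw [← Nat.add_assoc]; exact hτ', ?_⟩
      rw [orbit_succ_shift]
      exact hsub'

/-! ## §3 Under (ρ0) no line dies below the cutoff: the live lines cover every born region -/

variable {I}

/-- under `NoHealing K` every line of a level `< K` is alive after its 𝐑-operation [folklore] -/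
theorem aliveM_of_noHealing {K : ℕ} (h : I.NoHealing K) {j : ℕ} (hj : j < K) {τ : Line d} (hτ : τ ∈ I.StM j) :
    I.AliveM j τ :=
  (I.aliveM_iff_imp j τ).2 (h j hj τ hτ)

variable (I)

/-- **UNDER (ρ0) THE ORBIT OF EVERY BORN REGION LIES IN A LIVE LINE AT EVERY LEVEL UP TO THE CUTOFF**: `NoHealing K`,
`n ∈ N j`, `j + k ≤ K` ⇒ `S^k(n) ⊆ τ.D` for some `τ ∈ StM (j + k)`. [folklore] -/
theorem orbit_subset_live_of_noHealing {K : ℕ} (h : I.NoHealing K) {j : ℕ} {n : Lab d} (hn : n ∈ I.N j) {k : ℕ}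
    (hk : j + k ≤ K) : ∃ τ ∈ I.StM (j + k), orbit I.L I.s j n.2 k ⊆ τ.D :=
  I.orbit_subset_live_of_alive hn k fun i hi τ hτ => aliveM_of_noHealing h (by omega) hτ

/-- **THE COVER AT THE CUTOFF**: under `NoHealing K`, the `(K − j)`-th S-images of all regions born at a level `j ≤ K`
lie in the union of the live domains of `StM K` — the geometric presupposition of (1.71)'s «restricted to the
component» on OUR process: a key read off the live lines at the cutoff SEES every region the history created (while,
by `HistoryGenealogyFieldSight`, it does not see the new-field cubes). [folklore] -/
theorem regions_covered_at_cutoff {K : ℕ} (h : I.NoHealing K) {j : ℕ} (hj : j ≤ K) :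
    (I.N j).biUnion (fun n => orbit I.L I.s j n.2 (K - j)) ⊆ (I.StM K).biUnion Line.D := by
  intro x hx
  obtain ⟨n, hn, hxn⟩ := Finset.mem_biUnion.1 hx
  obtain ⟨τ, hτ, hsub⟩ := I.orbit_subset_live_of_noHealing h hn (k := K - j) (by omega)
  rw [Nat.add_sub_cancel' hj] at hτ
  exact Finset.mem_biUnion.2 ⟨τ, hτ, hsub hxn⟩

end RunInputM

/-! ## §4 Decided content on the LiveIndex toy -/

namespace LiveIndexToy

open RunInputM

/-- the toy's region is born at level `0` [folklore] -/
theorem reg_mem : reg ∈ toy.N 0 := by rw [toy_N_zero]; exact Finset.mem_singleton_self _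

/-- **CONTENT, POSITIVE SIDE**: while the toy's one line is unready (levels `< 2`) it is alive, so the origin cube's orbit
at level `2` lies in a live line of `StM 2` — by `orbit_subset_live_of_alive`, the carriers' alive-ness read off
`toy_not_stopsM_lt_two`. [folklore] -/
theorem toy_cover_two : ∃ τ ∈ toy.StM 2, orbit toy.L toy.s 0 reg.2 2 ⊆ τ.D := by
  have h := toy.orbit_subset_live_of_alive reg_mem 2 fun i hi τ hτ => by
    rw [Nat.zero_add] at hτ ⊢
    rw [toy.StM_eq_orbitLine toy_N_zero toy_N_pos i (fun l hl => toy_not_stopsM_lt_two l (lt_trans hl hi)),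
      Finset.mem_singleton] at hτ
    subst hτ
    exact (toy.aliveM_iff_imp i _).2 fun hr =>
      absurd ((toy.rdyM_orbitLine_iff reg.2 i).1 hr) (toy_not_stopsM_lt_two i hi)
  simpa only [Nat.zero_add] using h

/-- **CONTENT, NEGATIVE SIDE**: the toy violates `NoHealing 3` (its line heals at level `2`), so `regions_covered_at_cutoff`
does not apply at `K = 3` — and indeed nothing is live there to cover the orbit (`toy.StM 3 = ∅`, by
`HistoryGenealogyFieldSight.toy_StM_three`; here only the failed hypothesis is certified). [folklore] -/
theorem toy_noHealing_three_fails : ¬ toy.NoHealing 3 := toy_not_noHealing le_rfl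

end LiveIndexToy

end

end Summit.QuantumFields.BalabanUV.T4Continuum.HistoryGenealogyInstantiate
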